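import Literature.Probability.RandomPlanarGeometry.HexSAWStripPairsTransfer
import Literature.Probability.RandomPlanarGeometry.HexSAWBrickWallStripFugacity
import Mathlib.Analysis.SpecialFunctions.Pow.Real
import Mathlib.Analysis.SpecialFunctions.Pow.Continuity
import HarnessLib

/-!
# The growth rate `ν_T(y)` of the honeycomb strip `S_T` with a fugacity `y` on the TOP LEVEL (BBdGDCG14, Proposition 6,
# in the Duminil-Copin–Smirnov frame of the lane's `y_T`)

Topic `Literature/Probability/RandomPlanarGeometry` (continues `HexSAWStripPairsTransfer.lean` — the transfer `HV.toPair` of a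
self-avoiding vertex list of `ℍ` with levels in `[0, 2T − 1]` to a brick-wall strip pair of `HexBW.stripPairs (T − 1) ·` — and
reuses the splitting constant `HexBW.yK y = max 1 y⁻¹` of `HexSAWBrickWallStripFugacity.lean`).  Source: N. R. Beaton,
M. Bousquet-Mélou, J. de Gier, H. Duminil-Copin, A. J. Guttmann, *The critical fugacity for surface adsorption of self-avoiding
walks on the honeycomb lattice is `1 + √2`*, Comm. Math. Phys. 326 (2014) 727–754, arXiv:1109.0358v5, §3.2 Proposition 6 (p. 10:
"`lim c_{T,k}(y,z)^{1/k} := μ_T(y,z)`, where `μ_T(y,z)` is finite, and non-decreasing in `y` and `z`"; proof p. 11: "the existence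
of the limits follows from concatenation and unfolding arguments as given in Section 4 of [16]") with the weights of §3.2
(p. 10: "`c_{T,k}(y,z) = Σ_{|ω|=k} y^{bc(ω)} z^{tc(ω)}` … `bc(ω)` and `tc(ω)` are the numbers of contacts of `ω` with the bottom and top of the strip").

## What is defined and proved (namespace `Literature.Probability.RandomPlanarGeometry.SAW.HV`)

The lane's strip threshold `HV.stripYT T` (`HexSAWSurfaceFugacity.lean`) weighs the vertices of the TOP LEVEL `2T − 1` of the
Duminil-Copin–Smirnov strip `S_T` (levels `0, …, 2T − 1`; `HV.surfContacts`).  The growth rate matching THAT weight is built here,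
over translation classes of self-avoiding vertex lists of `ℍ` confined to the levels of `S_T` (head on the column `x₀ = 0`):

* `topCnt T l` (number of vertices of `l` on the level `2T − 1`), `InLev T l`, `xstd l` (horizontal standardisation, levels kept),
  `stripChains T n` (the `n`-step self-avoiding lists of `S_T` with standard head), `stripZL T n y = Σ y^{topCnt}`;
* `zigzag n ∈ stripChains T n` (`T ≥ 1`), `min_pow_le_stripZL`, `stripZL_pos`;
* **`stripZL_add_le`** — `Z_{n+m}(y) ≤ max(1,y⁻¹) Z_n(y) Z_m(y)` (split at the vertex `n`, the shared vertex weighted twice);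
* `stripNu T y := inf_n (max(1,y⁻¹) Z_{n+1}(y))^{1/(n+1)}`, **`tendsto_stripZL_rpow`** (`Z_n(y)^{1/n} → ν_T(y)`, Fekete),
  `pow_stripNu_le` (`ν_T(y)ⁿ ≤ max(1,y⁻¹) Z_n(y)`), `stripNu_pos`, `stripZL_mono_y`, `stripZL_scale_le`
  (`Z_n(λy) ≤ λ^{n+1} Z_n(y)`, `λ ≥ 1`), **`stripNu_mono_y`**, **`stripNu_scale_le`** (`ν_T(λy) ≤ λ ν_T(y)`) — the two one-sided
  moduli of continuity of `y ↦ ν_T(y)` used by `HexSAWStripSurfaceRadiusX.lean`.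

Label: lane bookkeeping (Proposition 6's existence statement for the top-level weight of the DCS frame, by sub-multiplicativity
over translation classes — Madras–Slade §8.2 (8.2.2)–(8.2.3) — rather than the printed unfolding); the identification with the
printed rooted partition functions is not asserted.  Lane «pcv-sawmu», a-p2 g10.
-/

noncomputable section

open Finset Filter Topology Literature.Probability.LatticeModels Literature.Probability.Percolation SimpleGraph

namespace Literature.Probability.RandomPlanarGeometry.SAW.HV

/-! ### Top-level counts, level confinement, horizontal standardisation -/

/-- The number of vertices of `l` on the top level `2T − 1` of `S_T` (the printed `j` of `c_{T,n}(i,j)`; the lane's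
`surfContacts` for inner lists). [cite: BeatonBousquetMelouDeGierDuminilCopinGuttmann2014, §3.2 (arXiv v5 p. 10: tc(ω), the contacts with the top of the strip)] -/
def topCnt (T : ℕ) (l : List HV) : ℕ := (l.filter fun v => lev v = 2 * (T : ℤ) - 1).length

/-- All vertices of `l` lie in the levels `0, …, 2T − 1` of `S_T`. [cite: DuminilCopinSmirnov2012, §3 (the strip S_T)] -/
def InLev (T : ℕ) (l : List HV) : Prop := ∀ v ∈ l, 0 ≤ lev v ∧ lev v ≤ 2 * (T : ℤ) - 1

/-- Decidability of `InLev`. [folklore] -/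
instance (T : ℕ) (l : List HV) : Decidable (InLev T l) := by unfold InLev; infer_instance

/-- `topCnt` is additive over concatenation. [cite: BeatonBousquetMelouDeGierDuminilCopinGuttmann2014, §3.2 (arXiv v5 p. 10: c_{T,k}(y,z) = Σ y^{bc(ω)} z^{tc(ω)}, tc(ω) = contacts with the top of the strip)] -/
theorem topCnt_append (T : ℕ) (l l' : List HV) : topCnt T (l ++ l') = topCnt T l + topCnt T l' := by
  simp [topCnt, List.filter_append]

/-- `topCnt` of a singleton. [cite: BeatonBousquetMelouDeGierDuminilCopinGuttmann2014, §3.2 (arXiv v5 p. 10: c_{T,k}(y,z) = Σ y^{bc(ω)} z^{tc(ω)}, tc(ω) = contacts with the top of the strip)] -/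
theorem topCnt_singleton (T : ℕ) (v : HV) : topCnt T [v] = if lev v = 2 * (T : ℤ) - 1 then 1 else 0 := by
  unfold topCnt; split_ifs with h <;> simp [h]

/-- `topCnt (v :: l) = [lev v = 2T-1] + topCnt l`. [cite: BeatonBousquetMelouDeGierDuminilCopinGuttmann2014, §3.2 (arXiv v5 p. 10: c_{T,k}(y,z) = Σ y^{bc(ω)} z^{tc(ω)}, tc(ω) = contacts with the top of the strip)] -/
theorem topCnt_cons (T : ℕ) (v : HV) (l : List HV) :
    topCnt T (v :: l) = (if lev v = 2 * (T : ℤ) - 1 then 1 else 0) + topCnt T l := by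
  rw [← List.singleton_append, topCnt_append, topCnt_singleton]

/-- `topCnt` is invariant under reversal. [cite: BeatonBousquetMelouDeGierDuminilCopinGuttmann2014, §3.2 (arXiv v5 p. 10: c_{T,k}(y,z) = Σ y^{bc(ω)} z^{tc(ω)}, tc(ω) = contacts with the top of the strip)] -/
theorem topCnt_reverse (T : ℕ) (l : List HV) : topCnt T l.reverse = topCnt T l := by
  simp [topCnt, List.filter_reverse]

/-- `topCnt l ≤ |l|`. [cite: BeatonBousquetMelouDeGierDuminilCopinGuttmann2014, §3.2 (arXiv v5 p. 10: c_{T,k}(y,z) = Σ y^{bc(ω)} z^{tc(ω)}, tc(ω) = contacts with the top of the strip)] -/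
theorem topCnt_le_length (T : ℕ) (l : List HV) : topCnt T l ≤ l.length := List.length_filter_le _ _

/-- A horizontal translation keeps `topCnt`. [cite: BeatonBousquetMelouDeGierDuminilCopinGuttmann2014, §3.2 (arXiv v5 p. 10: c_{T,k}(y,z) = Σ y^{bc(ω)} z^{tc(ω)}, tc(ω) = contacts with the top of the strip)] -/
theorem topCnt_map_shift (T : ℕ) (a : ℤ) (l : List HV) : topCnt T (l.map (shift a 0)) = topCnt T l := by
  unfold topCnt
  rw [List.filter_map, List.length_map]
  congr 1
  refine List.filter_congr fun v _ => ?_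
  simp only [Function.comp, lev_shift_zero]

/-- A horizontal translation keeps `InLev`. [cite: MadrasSlade1993, §8.2, eq. (8.2.1) (p. 267: the walks of a tube up to its translations)] -/
theorem inLev_map_shift {T : ℕ} (a : ℤ) {l : List HV} (h : InLev T l) : InLev T (l.map (shift a 0)) := by
  intro v hv
  rw [List.mem_map] at hv
  obtain ⟨w, hw, rfl⟩ := hv
  rw [lev_shift_zero]
  exact h w hw

/-- Horizontal standardisation: translate `l` along the strip so that its head lies on the column `x₀ = 0` (levels are kept).
[cite: MadrasSlade1993, §8.2, eq. (8.2.1) (walks of a tube up to its translations)] -/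
def xstd (l : List HV) : List HV := l.map (shift (-(l.headD hvOrigin).1) 0)

/-- `xstd` keeps lengths. [cite: MadrasSlade1993, §8.2, eq. (8.2.1) (p. 267: the walks of a tube up to its translations)] -/
@[simp] theorem length_xstd (l : List HV) : (xstd l).length = l.length := List.length_map _

/-- `xstd` keeps `topCnt`. [cite: BeatonBousquetMelouDeGierDuminilCopinGuttmann2014, §3.2 (arXiv v5 p. 10: c_{T,k}(y,z) = Σ y^{bc(ω)} z^{tc(ω)}, tc(ω) = contacts with the top of the strip)] -/
@[simp] theorem topCnt_xstd (T : ℕ) (l : List HV) : topCnt T (xstd l) = topCnt T l := topCnt_map_shift T _ l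

/-- `xstd` keeps `InLev`. [cite: MadrasSlade1993, §8.2, eq. (8.2.1) (p. 267: the walks of a tube up to its translations)] -/
theorem inLev_xstd {T : ℕ} {l : List HV} (h : InLev T l) : InLev T (xstd l) := inLev_map_shift _ h

/-- `xstd` keeps chains. [cite: MadrasSlade1993, §8.2, eq. (8.2.1) (p. 267: the walks of a tube up to its translations)] -/
theorem isChain_xstd {l : List HV} (h : l.IsChain hvGraph.Adj) : (xstd l).IsChain hvGraph.Adj := by
  rw [xstd, List.isChain_map]; exact h.imp fun x y hxy => (shift _ _).map_rel_iff.2 hxy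

/-- `xstd` keeps distinctness. [cite: MadrasSlade1993, §8.2, eq. (8.2.1) (p. 267: the walks of a tube up to its translations)] -/
theorem nodup_xstd {l : List HV} (h : l.Nodup) : (xstd l).Nodup := h.map (shift _ _).injective

/-- The head of `xstd l` is the head of `l` moved to the column `x₀ = 0`. [cite: MadrasSlade1993, §8.2, eq. (8.2.1) (p. 267: the walks of a tube up to its translations)] -/
theorem head?_xstd {l : List HV} {v : HV} (h : l.head? = some v) : (xstd l).head? = some (0, v.2.1, v.2.2) := by
  rw [xstd, List.head?_map, h, Option.map_some, List.headD_eq_head?_getD, h, Option.getD_some, shift_apply]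
  simp

/-- `xstd` is injective among lists with a common head. [cite: MadrasSlade1993, §8.2, eq. (8.2.1) (p. 267: the walks of a tube up to its translations)] -/
theorem xstd_inj_of_head {l l' : List HV} (h : xstd l = xstd l') (hh : l.head? = l'.head?) : l = l' := by
  have : l.headD hvOrigin = l'.headD hvOrigin := by rw [List.headD_eq_head?_getD, List.headD_eq_head?_getD, hh]
  rw [xstd, xstd, this] at h
  exact (List.map_injective_iff.2 (RelIso.injective _)) h

/-- Undoing `xstd`: `l = (xstd l).map (shift (head l).1 0)`. [cite: MadrasSlade1993, §8.2, eq. (8.2.1) (p. 267: the walks of a tube up to its translations)] -/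
theorem map_shift_xstd (l : List HV) : (xstd l).map (shift (l.headD hvOrigin).1 0) = l := by
  rw [xstd, List.map_map]
  conv_rhs => rw [← List.map_id l]
  refine List.map_congr_left fun v _ => ?_
  obtain ⟨a, b, c⟩ := v
  simp

/-! ### The self-avoiding lists of `S_T` with standard head, and `Z_n(y)` -/

/-- The standard heads: the `2T` vertices `(0, j, b)`, `j < T`, one on each level of `S_T`. [cite: MadrasSlade1993, §8.2, eq. (8.2.1)] -/
def stdHeads (T : ℕ) : Finset HV := (Finset.range T ×ˢ (univ : Finset Bool)).image fun jb => ((0 : ℤ), (jb.1 : ℤ), jb.2)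

/-- Membership in `stdHeads`: column `0` and level in `[0, 2T−1]`. [cite: MadrasSlade1993, §8.2, eq. (8.2.1) (p. 267: the walks of a tube up to its translations)] -/
theorem mem_stdHeads_iff {T : ℕ} {v : HV} : v ∈ stdHeads T ↔ v.1 = 0 ∧ 0 ≤ lev v ∧ lev v ≤ 2 * (T : ℤ) - 1 := by
  obtain ⟨a, b, c⟩ := v
  simp only [stdHeads, mem_image, mem_product, mem_range, mem_univ, and_true, Prod.exists, Prod.mk.injEq, lev_mk]
  constructor
  · rintro ⟨j, c', hj, rfl, rfl, rfl⟩
    cases c' <;> simp <;> omega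
  · rintro ⟨rfl, h0, h1⟩
    refine ⟨b.toNat, c, ?_, rfl, ?_, rfl⟩
    · cases c <;> simp at h0 h1 <;> omega
    · cases c <;> simp at h0 h1 <;> omega

/-- **The `n`-step self-avoiding vertex lists of `ℍ` confined to `S_T`, with head on the column `x₀ = 0`** (one list per
translation class of the strip). [cite: MadrasSlade1993, §8.2, eq. (8.2.1)] -/
def stripChains (T n : ℕ) : Finset (List HV) := ((stdHeads T).biUnion fun v => sawFin v n).filter (InLev T)

/-- Membership in `stripChains`. [cite: MadrasSlade1993, §8.2, eq. (8.2.1)] -/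
theorem mem_stripChains_iff {T n : ℕ} {l : List HV} :
    l ∈ stripChains T n ↔ l.IsChain hvGraph.Adj ∧ l.Nodup ∧ l.length = n + 1 ∧
      (∃ v, l.head? = some v ∧ v.1 = 0) ∧ InLev T l := by
  rw [stripChains, mem_filter, mem_biUnion]
  constructor
  · rintro ⟨⟨v, hv, hl⟩, hin⟩
    rw [mem_sawFin_iff, mem_sawLists_iff] at hl
    exact ⟨hl.1, hl.2.2.2, hl.2.2.1, ⟨v, hl.2.1, (mem_stdHeads_iff.1 hv).1⟩, hin⟩
  · rintro ⟨hc, hnd, hlen, ⟨v, hh, hv⟩, hin⟩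
    have hlv := hin v (List.mem_of_mem_head? hh)
    exact ⟨⟨v, mem_stdHeads_iff.2 ⟨hv, hlv⟩, mem_sawFin_iff.2 ⟨hc, hh, hlen, hnd⟩⟩, hin⟩

/-- Members of `stripChains` are nonempty. [cite: MadrasSlade1993, §8.2, eq. (8.2.1) (p. 267: the walks of a tube up to its translations)] -/
theorem ne_nil_of_mem_stripChains {T n : ℕ} {l : List HV} (h : l ∈ stripChains T n) : l ≠ [] := by
  rintro rfl; simp [mem_stripChains_iff] at h

/-- **`Z_n(y) := Σ_{ω ∈ stripChains T n} y^{topCnt ω}`** — the partition function of the `n`-step walks of `S_T` (translation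
classes) with a fugacity `y` per vertex on the top level. [cite: BeatonBousquetMelouDeGierDuminilCopinGuttmann2014, §3.2 (arXiv v5 p. 10: c_{T,k}(y,z) = Σ y^{bc(ω)} z^{tc(ω)}, here at y = 1)] -/
def stripZL (T n : ℕ) (y : ℝ) : ℝ := ∑ l ∈ stripChains T n, y ^ topCnt T l

/-- `Z_n(y) ≥ 0` for `y ≥ 0`. [cite: BeatonBousquetMelouDeGierDuminilCopinGuttmann2014, Proposition 6 (arXiv v5 p. 10)] -/
theorem stripZL_nonneg (T n : ℕ) {y : ℝ} (hy : 0 ≤ y) : 0 ≤ stripZL T n y := sum_nonneg fun _ _ => pow_nonneg hy _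

/-- `Z_n` is non-decreasing in `y ≥ 0`. [cite: BeatonBousquetMelouDeGierDuminilCopinGuttmann2014, Proposition 6 (arXiv v5 p. 10: non-decreasing in y and z)] -/
theorem stripZL_mono_y (T n : ℕ) {y y' : ℝ} (hy : 0 ≤ y) (hyy' : y ≤ y') : stripZL T n y ≤ stripZL T n y' :=
  sum_le_sum fun _ _ => pow_le_pow_left₀ hy hyy' _

/-- `Z_n(λ y) ≤ λ^{n+1} Z_n(y)` for `λ ≥ 1`, `y ≥ 0` (at most `n + 1` weighted vertices). [cite: BeatonBousquetMelouDeGierDuminilCopinGuttmann2014, Proposition 6 (arXiv v5 p. 10)] -/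
theorem stripZL_scale_le (T n : ℕ) {y c : ℝ} (hy : 0 ≤ y) (hc : 1 ≤ c) : stripZL T n (c * y) ≤ c ^ (n + 1) * stripZL T n y := by
  rw [stripZL, stripZL, mul_sum]
  refine sum_le_sum fun l hl => ?_
  have hk : topCnt T l ≤ n + 1 := (topCnt_le_length T l).trans (mem_stripChains_iff.1 hl).2.2.1.le
  rw [mul_pow]
  exact mul_le_mul_of_nonneg_right (pow_le_pow_right₀ hc hk) (pow_nonneg hy _)

/-! ### A walk of every length: the bottom zigzag -/

/-- The zigzag `(⌊i/2⌋, 0, [i odd])`, `i = 0, …, n`, along the two bottom levels of `S_T`. [cite: BeatonBousquetMelouDeGierDuminilCopinGuttmann2014, proof of Proposition 5 (arXiv v5 p. 9: zig-zag walks)] -/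
def zigzag (n : ℕ) : List HV := (List.range (n + 1)).map fun i => (((i / 2 : ℕ) : ℤ), (0 : ℤ), decide (i % 2 = 1))

/-- The zigzag is an `n`-step self-avoiding list of `S_T` with standard head (`T ≥ 1`). [cite: BeatonBousquetMelouDeGierDuminilCopinGuttmann2014, proof of Proposition 5 (arXiv v5 p. 9)] -/
theorem zigzag_mem {T : ℕ} (hT : 1 ≤ T) (n : ℕ) : zigzag n ∈ stripChains T n := by
  rw [mem_stripChains_iff]
  refine ⟨?_, ?_, by simp [zigzag], ⟨(0, 0, false), by simp [zigzag, List.range_succ_eq_map], rfl⟩, ?_⟩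
  · rw [zigzag, List.isChain_map, List.isChain_range_succ]
    intro m _
    rcases Nat.even_or_odd m with ⟨k, hk⟩ | ⟨k, hk⟩
    · have e1 : m / 2 = k := by omega
      have e2 : (m + 1) / 2 = k := by omega
      have e3 : decide (m % 2 = 1) = false := decide_eq_false (by omega)
      have e4 : decide ((m + 1) % 2 = 1) = true := decide_eq_true (by omega)
      rw [Nat.succ_eq_add_one, e1, e2, e3, e4]
      simp [hvGraph_adj, AdjRel]
    · have e1 : m / 2 = k := by omega
      have e2 : (m + 1) / 2 = k + 1 := by omega
      have e3 : decide (m % 2 = 1) = true := decide_eq_true (by omega)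
      have e4 : decide ((m + 1) % 2 = 1) = false := decide_eq_false (by omega)
      rw [Nat.succ_eq_add_one, e1, e2, e3, e4]
      simp [hvGraph_adj, AdjRel]
  · rw [zigzag]
    refine (List.nodup_range).map_on fun i _ j _ h => ?_
    simp only [Prod.mk.injEq, Nat.cast_inj, decide_eq_decide] at h
    omega
  · intro v hv
    rw [zigzag, List.mem_map] at hv
    obtain ⟨i, -, rfl⟩ := hv
    by_cases h : i % 2 = 1
    · rw [decide_eq_true h]; simp; omega
    · rw [decide_eq_false h]; simp; omega

/-- `min(1,y)^{n+1} ≤ Z_n(y)` for `y > 0`, `T ≥ 1` (the zigzag alone). [cite: BeatonBousquetMelouDeGierDuminilCopinGuttmann2014, Proposition 6 (arXiv v5 p. 10)] -/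
theorem min_pow_le_stripZL {T : ℕ} (hT : 1 ≤ T) (n : ℕ) {y : ℝ} (hy : 0 < y) : (min 1 y) ^ (n + 1) ≤ stripZL T n y := by
  have hmin : 0 < min 1 y := lt_min one_pos hy
  have h1 : (min 1 y) ^ (n + 1) ≤ y ^ topCnt T (zigzag n) := by
    have hk : topCnt T (zigzag n) ≤ n + 1 := (topCnt_le_length T _).trans (by simp [zigzag])
    rcases le_or_gt 1 y with h | h
    · rw [min_eq_left h, one_pow]; exact one_le_pow₀ h
    · rw [min_eq_right h.le]; exact pow_le_pow_of_le_one hy.le h.le hk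
  exact h1.trans (single_le_sum (f := fun l => y ^ topCnt T l) (fun _ _ => pow_nonneg hy.le _) (zigzag_mem hT n))

/-- `0 < Z_n(y)` for `y > 0`, `T ≥ 1`. [cite: BeatonBousquetMelouDeGierDuminilCopinGuttmann2014, Proposition 6 (arXiv v5 p. 10)] -/
theorem stripZL_pos {T : ℕ} (hT : 1 ≤ T) (n : ℕ) {y : ℝ} (hy : 0 < y) : 0 < stripZL T n y :=
  lt_of_lt_of_le (pow_pos (lt_min one_pos hy) _) (min_pow_le_stripZL hT n hy)


/-! ### Sub-multiplicativity: splitting at the vertex `n` -/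

section Split

variable {T n m : ℕ} {l : List HV}

/-- The first piece of the split at the vertex `n`: the first `n` steps. [cite: MadrasSlade1993, §8.2, (8.2.2)] -/
def splFst (n : ℕ) (l : List HV) : List HV := l.take (n + 1)

/-- The second piece of the split at the vertex `n`: the remaining steps, standardised horizontally. [cite: MadrasSlade1993, §8.2, (8.2.2)] -/
def splSnd (n : ℕ) (l : List HV) : List HV := xstd (l.drop n)

/-- The first piece is an `n`-step list of `S_T`. [cite: MadrasSlade1993, §8.2, (8.2.2)] -/
theorem splFst_mem (hl : l ∈ stripChains T (n + m)) : splFst n l ∈ stripChains T n := by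
  obtain ⟨hc, hnd, hlen, ⟨v, hh, hv⟩, hin⟩ := mem_stripChains_iff.1 hl
  rw [mem_stripChains_iff, splFst]
  refine ⟨hc.take _, hnd.sublist (List.take_sublist _ _), by rw [List.length_take]; omega,
    ⟨v, by rw [List.head?_take]; simpa using hh, hv⟩, fun w hw => hin w (List.mem_of_mem_take hw)⟩

/-- The second piece is an `m`-step list of `S_T`. [cite: MadrasSlade1993, §8.2, (8.2.2)] -/
theorem splSnd_mem (hl : l ∈ stripChains T (n + m)) : splSnd n l ∈ stripChains T m := by
  obtain ⟨hc, hnd, hlen, -, hin⟩ := mem_stripChains_iff.1 hl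
  have hn : n < l.length := by omega
  rw [mem_stripChains_iff, splSnd]
  refine ⟨isChain_xstd (hc.drop _), nodup_xstd (hnd.sublist (List.drop_sublist _ _)),
    by rw [length_xstd, List.length_drop]; omega, ?_, inLev_xstd fun w hw => hin w (List.mem_of_mem_drop hw)⟩
  exact ⟨(0, (l[n]).2.1, (l[n]).2.2), head?_xstd (by rw [List.head?_drop, List.getElem?_eq_getElem hn]), rfl⟩

/-- The top counts of the two pieces: the split vertex is counted twice. [cite: BeatonBousquetMelouDeGierDuminilCopinGuttmann2014, §3.2 (arXiv v5 p. 10: c_{T,k}(y,z) = Σ y^{bc(ω)} z^{tc(ω)}, tc(ω) = contacts with the top of the strip)] -/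
theorem topCnt_spl (hl : l ∈ stripChains T (n + m)) :
    topCnt T (splFst n l) + topCnt T (splSnd n l) =
      topCnt T l + if lev (l[n]'(by have := (mem_stripChains_iff.1 hl).2.2.1; omega)) = 2 * (T : ℤ) - 1 then 1 else 0 := by
  have hlen := (mem_stripChains_iff.1 hl).2.2.1
  have hn : n < l.length := by omega
  have e1 : splFst n l = l.take n ++ [l[n]] := by
    rw [splFst, List.take_add_one, List.getElem?_eq_getElem hn]; rfl
  have e2 : l.drop n = l[n] :: l.drop (n + 1) := List.drop_eq_getElem_cons hn
  have e3 : topCnt T l = topCnt T (l.take n) + topCnt T (l.drop n) := by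
    rw [← topCnt_append, List.take_append_drop]
  rw [splSnd, topCnt_xstd, e1, e2, topCnt_append, topCnt_singleton, topCnt_cons, e3, e2, topCnt_cons]
  omega

/-- The split is injective on `stripChains T (n + m)`. [cite: MadrasSlade1993, §8.2, (8.2.2)] -/
theorem spl_injOn : Set.InjOn (fun l => (splFst n l, splSnd n l)) (stripChains T (n + m) : Set (List HV)) := by
  intro l hl l' hl' h
  simp only [Prod.mk.injEq] at h
  obtain ⟨h1, h2⟩ := h
  rw [mem_coe] at hl hl'
  have hlen := (mem_stripChains_iff.1 hl).2.2.1
  have hlen' := (mem_stripChains_iff.1 hl').2.2.1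
  have hn : n < l.length := by omega
  have hn' : n < l'.length := by omega
  rw [splFst, splFst] at h1
  have hgn : l[n] = l'[n] := by
    have e1 : (l.take (n + 1))[n]? = l[n]? := List.getElem?_take_of_lt (by omega)
    have e2 : (l'.take (n + 1))[n]? = l'[n]? := List.getElem?_take_of_lt (by omega)
    rw [h1] at e1
    have := e1.symm.trans e2
    rwa [List.getElem?_eq_getElem hn, List.getElem?_eq_getElem hn', Option.some_inj] at this
  have hdrop : l.drop n = l'.drop n := by
    rw [splSnd, splSnd] at h2
    refine xstd_inj_of_head h2 ?_
    rw [List.head?_drop, List.head?_drop, List.getElem?_eq_getElem hn, List.getElem?_eq_getElem hn', hgn]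
  have htake : l.take n = l'.take n := by
    have := congrArg (List.take n) h1
    rwa [List.take_take, List.take_take, min_eq_left (Nat.le_succ _)] at this
  calc l = l.take n ++ l.drop n := (List.take_append_drop _ _).symm
    _ = l'.take n ++ l'.drop n := by rw [htake, hdrop]
    _ = l' := List.take_append_drop _ _

end Split

/-- **Sub-multiplicativity with the top-level weight**: `Z_{n+m}(y) ≤ max(1,y⁻¹) Z_n(y) Z_m(y)` (`y > 0`).
[cite: MadrasSlade1993, §8.2, (8.2.2)–(8.2.3) (p. 267) — weighted form; BeatonBousquetMelouDeGierDuminilCopinGuttmann2014, Proposition 6 (arXiv v5 p. 10)] -/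
theorem stripZL_add_le (T n m : ℕ) {y : ℝ} (hy : 0 < y) :
    stripZL T (n + m) y ≤ HexBW.yK y * stripZL T n y * stripZL T m y := by
  classical
  have hK := HexBW.one_le_yK y
  have hpt : ∀ l ∈ stripChains T (n + m),
      y ^ topCnt T l ≤ HexBW.yK y * (y ^ topCnt T (splFst n l) * y ^ topCnt T (splSnd n l)) := by
    intro l hl
    have e := topCnt_spl (T := T) (n := n) (m := m) hl
    rw [← pow_add, e, pow_add]
    split_ifs
    · rw [pow_one]
      calc y ^ topCnt T l = y⁻¹ * (y ^ topCnt T l * y) := by field_simp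
        _ ≤ HexBW.yK y * (y ^ topCnt T l * y) := mul_le_mul_of_nonneg_right (HexBW.inv_le_yK y) (by positivity)
    · rw [pow_zero, mul_one]
      exact le_mul_of_one_le_left (by positivity) hK
  calc stripZL T (n + m) y
      ≤ ∑ l ∈ stripChains T (n + m), HexBW.yK y * (y ^ topCnt T (splFst n l) * y ^ topCnt T (splSnd n l)) :=
        sum_le_sum hpt
    _ = HexBW.yK y * ∑ l ∈ stripChains T (n + m), y ^ topCnt T (splFst n l) * y ^ topCnt T (splSnd n l) := by
        rw [mul_sum]
    _ ≤ HexBW.yK y * ∑ q ∈ stripChains T n ×ˢ stripChains T m, y ^ topCnt T q.1 * y ^ topCnt T q.2 := by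
        refine mul_le_mul_of_nonneg_left ?_ (by linarith)
        exact sum_le_sum_of_injOn_of_nonneg (fun l => (splFst n l, splSnd n l)) spl_injOn
          (fun l hl => mem_product.2 ⟨splFst_mem hl, splSnd_mem hl⟩)
          (fun q => y ^ topCnt T q.1 * y ^ topCnt T q.2) fun _ _ => by positivity
    _ = HexBW.yK y * stripZL T n y * stripZL T m y := by
        rw [sum_product, stripZL, stripZL, mul_assoc, sum_mul_sum]

/-! ### The growth rate `ν_T(y)` (Fekete) -/

/-- **`ν_T(y) := inf_n (max(1,y⁻¹) Z_{n+1}(y))^{1/(n+1)}`** (`= lim Z_n(y)^{1/n}`, `tendsto_stripZL_rpow`): the growth rate of the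
self-avoiding walks of `S_T` with a fugacity `y` per vertex on the top level.
[cite: BeatonBousquetMelouDeGierDuminilCopinGuttmann2014, Proposition 6 (arXiv v5 p. 10: lim c_{T,k}(y,z)^{1/k} := μ_T(y,z); proof p. 11)] -/
def stripNu (T : ℕ) (y : ℝ) : ℝ := ⨅ n : ℕ, (HexBW.yK y * stripZL T (n + 1) y) ^ (1 / ((n : ℝ) + 1))

/-- `ν_T(y) ≤ (max(1,y⁻¹) Z_n(y))^{1/n}` for `n ≥ 1`. [cite: BeatonBousquetMelouDeGierDuminilCopinGuttmann2014, Proposition 6 (arXiv v5 p. 10)] -/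
theorem stripNu_le_rpow {T : ℕ} (hT : 1 ≤ T) {y : ℝ} (hy : 0 < y) {n : ℕ} (hn : n ≠ 0) :
    stripNu T y ≤ (HexBW.yK y * stripZL T n y) ^ (1 / (n : ℝ)) := by
  obtain ⟨m, rfl⟩ := Nat.exists_eq_succ_of_ne_zero hn
  have hb : BddBelow (Set.range fun m : ℕ => (HexBW.yK y * stripZL T (m + 1) y) ^ (1 / ((m : ℝ) + 1))) :=
    ⟨0, by
      rintro _ ⟨m, rfl⟩
      exact Real.rpow_nonneg (mul_nonneg (by linarith [HexBW.one_le_yK y]) (stripZL_pos hT _ hy).le) _⟩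
  have := ciInf_le hb m
  simpa [stripNu, Nat.cast_succ] using this

/-- **`ν_T(y)ⁿ ≤ max(1,y⁻¹) Z_n(y)`**. [cite: BeatonBousquetMelouDeGierDuminilCopinGuttmann2014, Proposition 6 (arXiv v5 p. 10)] -/
theorem pow_stripNu_le {T : ℕ} (hT : 1 ≤ T) (n : ℕ) {y : ℝ} (hy : 0 < y) (hν : 0 ≤ stripNu T y) :
    stripNu T y ^ n ≤ HexBW.yK y * stripZL T n y := by
  have hK := HexBW.one_le_yK y
  have hKZ : 0 ≤ HexBW.yK y * stripZL T n y := mul_nonneg (by linarith) (stripZL_pos hT n hy).le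
  rcases Nat.eq_zero_or_pos n with rfl | hn
  · rw [pow_zero]
    have := min_pow_le_stripZL hT 0 hy
    rw [zero_add, pow_one] at this
    rcases le_or_gt 1 y with h1 | h1
    · rw [min_eq_left h1] at this
      calc (1 : ℝ) = 1 * 1 := by ring
        _ ≤ HexBW.yK y * stripZL T 0 y := mul_le_mul hK this zero_le_one (by linarith)
    · rw [min_eq_right h1.le] at this
      calc (1 : ℝ) = y⁻¹ * y := by field_simp
        _ ≤ HexBW.yK y * stripZL T 0 y := mul_le_mul (HexBW.inv_le_yK y) this hy.le (by linarith)
  · have h := stripNu_le_rpow hT hy hn.ne'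
    calc stripNu T y ^ n ≤ ((HexBW.yK y * stripZL T n y) ^ (1 / (n : ℝ))) ^ n := pow_le_pow_left₀ hν h n
      _ = HexBW.yK y * stripZL T n y := by rw [one_div, Real.rpow_inv_natCast_pow hKZ hn.ne']

/-- **`Z_n(y)^{1/n} → ν_T(y)`** (Fekete's lemma for the subadditive `log(max(1,y⁻¹) Z_n(y))`).
[cite: BeatonBousquetMelouDeGierDuminilCopinGuttmann2014, Proposition 6 (arXiv v5 p. 10: lim c_{T,k}(y,z)^{1/k} := μ_T(y,z); proof p. 11); MadrasSlade1993, Lemma 1.2.2 (p. 9)] -/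
theorem tendsto_stripZL_rpow {T : ℕ} (hT : 1 ≤ T) {y : ℝ} (hy : 0 < y) :
    Tendsto (fun n : ℕ => (stripZL T n y) ^ (1 / (n : ℝ))) atTop (𝓝 (stripNu T y)) := by
  have hK := HexBW.one_le_yK y
  have hK0 : 0 < HexBW.yK y := by linarith
  have hpos : ∀ n, 0 < HexBW.yK y * stripZL T n y := fun n => mul_pos hK0 (stripZL_pos hT n hy)
  have hu : Subadditive fun n => Real.log (HexBW.yK y * stripZL T n y) := by
    intro m n
    rw [← Real.log_mul (hpos m).ne' (hpos n).ne']
    apply Real.log_le_log (hpos _)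
    have h := stripZL_add_le T m n hy
    calc HexBW.yK y * stripZL T (m + n) y ≤ HexBW.yK y * (HexBW.yK y * stripZL T m y * stripZL T n y) :=
          mul_le_mul_of_nonneg_left h hK0.le
      _ = HexBW.yK y * stripZL T m y * (HexBW.yK y * stripZL T n y) := by ring
  have hmin : 0 < min 1 y := lt_min one_pos hy
  have hbdd : BddBelow (Set.range fun n : ℕ => Real.log (HexBW.yK y * stripZL T n y) / n) := by
    refine ⟨2 * Real.log (min 1 y), ?_⟩
    rintro _ ⟨n, rfl⟩
    have hlog0 : Real.log (min 1 y) ≤ 0 := Real.log_nonpos hmin.le (min_le_left _ _)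
    rcases Nat.eq_zero_or_pos n with rfl | hn
    · simp only [Nat.cast_zero, div_zero]; linarith
    · have h1 : (min 1 y) ^ (n + 1) ≤ HexBW.yK y * stripZL T n y :=
        (min_pow_le_stripZL hT n hy).trans (le_mul_of_one_le_left (stripZL_pos hT n hy).le hK)
      have h2 : ((n : ℝ) + 1) * Real.log (min 1 y) ≤ Real.log (HexBW.yK y * stripZL T n y) := by
        have := Real.log_le_log (pow_pos hmin _) h1
        rwa [Real.log_pow, Nat.cast_succ] at this
      rw [le_div_iff₀ (by exact_mod_cast hn)]
      have hn1 : (1 : ℝ) ≤ n := by exact_mod_cast hn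
      nlinarith
  have hlim := hu.tendsto_lim hbdd
  have hKlim : Tendsto (fun n : ℕ => (HexBW.yK y) ^ (1 / (n : ℝ))) atTop (𝓝 1) := by
    have h1 : Tendsto (fun n : ℕ => Real.log (HexBW.yK y) / (n : ℝ)) atTop (𝓝 0) :=
      tendsto_const_div_atTop_nhds_zero_nat _
    have h2 := (Real.continuous_exp.tendsto _).comp h1
    rw [Real.exp_zero] at h2
    refine h2.congr fun n => ?_
    rw [Function.comp_apply, Real.rpow_def_of_pos hK0, mul_one_div]
  have key : ∀ n : ℕ, (HexBW.yK y * stripZL T n y) ^ (1 / (n : ℝ)) =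
      Real.exp (Real.log (HexBW.yK y * stripZL T n y) / n) :=
    fun n => by rw [Real.rpow_def_of_pos (hpos n), mul_one_div]
  have hexp : Tendsto (fun n : ℕ => (HexBW.yK y * stripZL T n y) ^ (1 / (n : ℝ))) atTop (𝓝 (Real.exp hu.lim)) := by
    rw [show (fun n : ℕ => (HexBW.yK y * stripZL T n y) ^ (1 / (n : ℝ))) =
      fun n => Real.exp (Real.log (HexBW.yK y * stripZL T n y) / n) from funext key]
    exact (Real.continuous_exp.tendsto _).comp hlim
  have hid : Real.exp hu.lim = stripNu T y := by
    apply le_antisymm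
    · refine le_ciInf fun n => ?_
      have h1 := hu.lim_le_div hbdd (Nat.succ_ne_zero n)
      have h2 := Real.exp_le_exp.2 h1
      rw [← key (n + 1)] at h2
      simpa [Nat.cast_succ] using h2
    · refine ge_of_tendsto hexp ?_
      filter_upwards [eventually_ge_atTop 1] with n hn
      exact stripNu_le_rpow hT hy (by omega)
  have hprod : Tendsto (fun n : ℕ => (HexBW.yK y)⁻¹ ^ (1 / (n : ℝ)) * (HexBW.yK y * stripZL T n y) ^ (1 / (n : ℝ)))
      atTop (𝓝 (stripNu T y)) := by
    have h1 : Tendsto (fun n : ℕ => (HexBW.yK y)⁻¹ ^ (1 / (n : ℝ))) atTop (𝓝 1) := by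
      have := hKlim.inv₀ one_ne_zero
      rw [inv_one] at this
      refine this.congr fun n => ?_
      rw [Real.inv_rpow hK0.le]
    have := h1.mul hexp
    rwa [one_mul, hid] at this
  refine hprod.congr fun n => ?_
  rw [← Real.mul_rpow (inv_nonneg.2 hK0.le) (hpos n).le, ← mul_assoc, inv_mul_cancel₀ hK0.ne', one_mul]

/-- `0 < ν_T(y)` (indeed `ν_T(y) ≥ min(1,y)²`), `T ≥ 1`, `y > 0`. [cite: BeatonBousquetMelouDeGierDuminilCopinGuttmann2014, Proposition 6 (arXiv v5 p. 10)] -/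
theorem stripNu_pos {T : ℕ} (hT : 1 ≤ T) {y : ℝ} (hy : 0 < y) : 0 < stripNu T y := by
  have hmin : 0 < min 1 y := lt_min one_pos hy
  have hK := HexBW.one_le_yK y
  have h : (min 1 y) ^ 2 ≤ stripNu T y := by
    refine le_ciInf fun n => ?_
    have h1 : (min 1 y) ^ (n + 1 + 1) ≤ HexBW.yK y * stripZL T (n + 1) y :=
      (min_pow_le_stripZL hT (n + 1) hy).trans (le_mul_of_one_le_left (stripZL_pos hT _ hy).le hK)
    have h2 : ((min 1 y) ^ (n + 1 + 1)) ^ (1 / ((n : ℝ) + 1)) ≤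
        (HexBW.yK y * stripZL T (n + 1) y) ^ (1 / ((n : ℝ) + 1)) :=
      Real.rpow_le_rpow (pow_nonneg hmin.le _) h1 (by positivity)
    refine le_trans ?_ h2
    rw [← Real.rpow_natCast (min 1 y) (n + 1 + 1), ← Real.rpow_mul hmin.le]
    have hle1 : min 1 y ≤ 1 := min_le_left _ _
    have hexp : ((n + 1 + 1 : ℕ) : ℝ) * (1 / ((n : ℝ) + 1)) ≤ 2 := by
      rw [mul_one_div, div_le_iff₀ (by positivity)]; push_cast; linarith
    calc (min 1 y) ^ 2 = (min 1 y) ^ (2 : ℝ) := by norm_cast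
      _ ≤ (min 1 y) ^ (((n + 1 + 1 : ℕ) : ℝ) * (1 / ((n : ℝ) + 1))) :=
          Real.rpow_le_rpow_of_exponent_ge hmin hle1 hexp
  exact lt_of_lt_of_le (pow_pos hmin 2) h

/-- **`ν_T` is non-decreasing in `y`** (`0 < y ≤ y'`). [cite: BeatonBousquetMelouDeGierDuminilCopinGuttmann2014, Proposition 6 (arXiv v5 p. 10: "non-decreasing in y and z")] -/
theorem stripNu_mono_y {T : ℕ} (hT : 1 ≤ T) {y y' : ℝ} (hy : 0 < y) (hyy' : y ≤ y') : stripNu T y ≤ stripNu T y' :=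
  le_of_tendsto_of_tendsto' (tendsto_stripZL_rpow hT hy) (tendsto_stripZL_rpow hT (hy.trans_le hyy')) fun n =>
    Real.rpow_le_rpow (stripZL_nonneg T n hy.le) (stripZL_mono_y T n hy.le hyy') (by positivity)

/-- **`ν_T(λ y) ≤ λ ν_T(y)`** for `λ ≥ 1`, `y > 0` (a walk of `n` steps has at most `n + 1` weighted vertices): with
`stripNu_mono_y`, the modulus of continuity of `y ↦ ν_T(y)` on `(0, ∞)`.
[cite: BeatonBousquetMelouDeGierDuminilCopinGuttmann2014, Proposition 6 (arXiv v5 p. 10: μ_T(1,y) is continuous)] -/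
theorem stripNu_scale_le {T : ℕ} (hT : 1 ≤ T) {y c : ℝ} (hy : 0 < y) (hc : 1 ≤ c) :
    stripNu T (c * y) ≤ c * stripNu T y := by
  have hc0 : 0 < c := by linarith
  have hcy : 0 < c * y := mul_pos hc0 hy
  -- `Z_n(cy)^{1/n} ≤ (c^{n+1})^{1/n} Z_n(y)^{1/n}` and `(c^{n+1})^{1/n} → c`
  have hclim : Tendsto (fun n : ℕ => (c ^ (n + 1)) ^ (1 / (n : ℝ))) atTop (𝓝 c) := by
    have h1 : Tendsto (fun n : ℕ => c ^ (1 / (n : ℝ))) atTop (𝓝 1) := by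
      have h1 : Tendsto (fun n : ℕ => Real.log c / (n : ℝ)) atTop (𝓝 0) := tendsto_const_div_atTop_nhds_zero_nat _
      have h2 := (Real.continuous_exp.tendsto _).comp h1
      rw [Real.exp_zero] at h2
      refine h2.congr fun n => ?_
      rw [Function.comp_apply, Real.rpow_def_of_pos hc0, mul_one_div]
    have h2 := h1.mul (tendsto_const_nhds (x := c))
    rw [one_mul] at h2
    refine h2.congr' ?_
    filter_upwards [eventually_ge_atTop 1] with n hn
    have hn0 : (n : ℝ) ≠ 0 := by exact_mod_cast (by omega : n ≠ 0)
    rw [pow_succ, Real.mul_rpow (pow_nonneg hc0.le _) hc0.le, ← Real.rpow_natCast, ← Real.rpow_mul hc0.le,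
      mul_one_div_cancel hn0, Real.rpow_one, mul_comm]
  have hlim := hclim.mul (tendsto_stripZL_rpow hT hy)
  refine le_of_tendsto_of_tendsto' (tendsto_stripZL_rpow hT hcy) hlim fun n => ?_
  rw [← Real.mul_rpow (pow_nonneg hc0.le _) (stripZL_nonneg T n hy.le)]
  exact Real.rpow_le_rpow (stripZL_nonneg T n hcy.le) (stripZL_scale_le T n hy.le hc) (by positivity)

end Literature.Probability.RandomPlanarGeometry.SAW.HV
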